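/-
Copyright: the b2b-balaban T⁴-continuum CRUX team, row NE7b leaf lineage `t4-ne7b-formalise-leaf-03` (gen 156). Project licence.
-/
import Summits.QuantumFields.BalabanUV.T4Continuum.Spine.NE7b.SupTorusEffectiveActionInstance

/-!
# THE CRITICAL POINTS OF THE TORUS EFFECTIVE ACTION ARE EXACTLY THE COARSE FIELDS WHOSE BACKGROUND SOLVES THE UNCONSTRAINED FIELD
# EQUATION: on the open torus ball, `D(S∘σt)(wt) = 0 ⟺ A(Ef σt wt) + u∘(Ef σt wt) = 0` at every lattice site — the variational form of
# `…SupInductiveStepLattice`'s «zeros of the next equation map lift» on the `Beta.Site` carriers: the gradient is `(n+1)^d ×` the coarse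
# block means `λ(wt)` of the field equation (INST), `λ(wt) = 0` forces `Σ_y λ y² = 0`, and a periodic block-constant lattice field with
# vanishing block means vanishes (row NE7b, node U5c; INST + TDF + PTC BY NAME; [folklore])

Cell `pub-balaban`, sub-cell `t4`, spine estimate NE7b (`T4WeightBudget.RelWeightBound`; the cell's OWN estimate — NOT PRINTED in
[Bałaban 1983–89], NOT PROVED).  Crux-route work under `Spine/NE7b/` by a row leaf (`t4-ne7b-formalise-leaf-03` gen 156) under
FREEZE (0)'s crux-prover clause, completing the row OWNER's located item [NE7bP1-G116-HANDOFF] NEXT (3)(iii) (the variational junction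
on the torus) with its zeroth-order reading; NOTHING of Bałaban's is named as a Lean object, valued or asserted; no `T4Continuum/Support`
leaf typed; no `def`, no notation; zero `sorry`.  Imports (BY NAME): this lineage's INST `…SupTorusEffectiveActionInstance`
(`fderiv_effectiveAction_torus_apply`, `hasFDerivAt_effectiveAction_torus_of_letters`, `fieldEq_periodic`; through it SBTL
`exists_background_torus_localised`, TDF `apply_windowMap_of_blockConst`, TEA `exists_clm_pair`, PTC `apply_windowMap_siteOf` ∕
`natCast_mul_smul_eq`).

WHAT IS PROVED ([folklore]; `ℓ^∞ := lp (fun _ : X d => ℝ) ∞`; coarse torus `Site d s`, `[NeZero s]`, fine `Site d ((n+1)*s)`;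
operators ∕ carriers by DISPLAYED actions; `S∘σt := fun w => ½·Σ_x (σt w) x·((Rf∘A∘Ef)(σt w)) x + Σ_x v((σt w) x)`;
`λ(φ) y := (n+1)^{−d}·Σ_{p′ ∈ B n (windowMap y)} ((A(Ef φ))(p′) + u((Ef φ)(p′)))`):
* §1 `sum_mul_self_eq_zero_iff` (a finite sum of squares vanishes iff every term does), `fieldEq_apply_eq_blockMean` (under the
  sitewise equation the field equation at ANY lattice site is `λ` at the torus block of its class — periodicity + TDF's reading),
  **`fieldEq_eq_zero_of_blockMean_eq_zero`** (`λ(φ) = 0` ⟹ the field equation of `Ef φ` vanishes identically on `ℤ^d`),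
  `blockMean_eq_zero_of_fieldEq_eq_zero` (conversely).
* §2 **`fderiv_effectiveAction_torus_eq_zero_iff`** (letters form: ANY `σ ∕ σt ∕ D` with INST §3's letters at `wt` ⟹
  `fderiv (S∘σt) wt = 0 ↔ ∀ p, (A(Ef(σt wt)))(p) + u((Ef(σt wt))(p)) = 0`).
* §3 **`exists_effectiveAction_critical_torus`** (`d ≥ 3`; SBTL's binders VERBATIM + a primitive `v` of `u`; every `s ≥ 1`): SBTL's
  letters re-exported WITH `σt 0 = 0` and the closed-ball identification (the five letters that pin `σt`), and on the open
  torus ball `‖wt‖ < (N⁻¹ − c)r`, `wt` IS A CRITICAL POINT OF THE TORUS EFFECTIVE ACTION IFF ITS BACKGROUND `Ef(σt wt) = σ(Ec wt)` SOLVES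
  THE UNCONSTRAINED FIELD EQUATION `A φ + u∘φ = 0` ON THE LATTICE.
* §4 toy.

HONEST (what this is NOT).  First-order reading only: which critical points exist ∕ are minima (the Hessian row is HESS; its floor is NOT
typed), and nothing about the measure; constants (63)'s; cubic periods; scalar skeleton, not the covariant operators ((A3), NC-NE7b-α
UNRULED); nothing of Bałaban's.  BY-NAME EFFECT ON THE WALL: NONE.  NE7b NOT PRINTED ∕ NOT PROVED; spine PROVED 0∕9; rung (B)+1 on a FINITE
torus — NOT infinite volume, NOT the mass gap, NOT Clay.  HONEST DEPENDENCY: continuum YM on T⁴ ⇐ BetaPertH ∧ nine spine estimates (0∕9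
proved); BetaPertH ⇐ (D1) ∧ (D4) ∧ CAP+tail; G-an2-4 gates asym, D1 and NE2∕3∕4.
-/

set_option autoImplicit false

noncomputable section

namespace Summit.QuantumFields.BalabanUV.T4Continuum.NE7b.SupTorusEffectiveActionCritical

open Set Metric Function
open scoped ENNReal NNReal Topology
open Literature.MathematicalPhysics.QuantumFieldTheory.Balaban1983to89
open B4Sect5Proof (latticeConst latticeConst_nonneg)
open B6QGQLower276 (X blk B side AX)
open B6QGQDecay237 (deltaU)
open B5Hk103ScalarZd (nbhd deltaH)
open Summit.QuantumFields.BalabanUV.Beta.D1BFx.BlockColumnSupNorm (cHs)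
open Summit.QuantumFields.BalabanUV.Beta.D1BFx.PointColumnSplit (cKL cG0 cSplit)
open Summit.QuantumFields.BalabanUV.Beta.D1BFx.PointColumnDecay (cFar)
open Beta (Site siteOf windowMap siteOf_windowMap)
open PeriodicSupTorusCarrier (apply_windowMap_siteOf natCast_mul_smul_eq)
open SupTorusDirichletForm (apply_windowMap_of_blockConst)
open SupTorusEffectiveAction (exists_clm_pair)
open SupTorusEffectiveActionInstance (fderiv_effectiveAction_torus_apply hasFDerivAt_effectiveAction_torus_of_letters fieldEq_periodic)
open SupBackgroundTorusLocalised (exists_background_torus_localised)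

variable {d : ℕ}

/-! ## §1. Block means of the field equation vanish iff the field equation vanishes -/

/-- A finite sum of squares vanishes iff every term does. [folklore] -/
theorem sum_mul_self_eq_zero_iff {κ : Type*} [Fintype κ] (c : κ → ℝ) : ∑ y, c y * c y = 0 ↔ ∀ y, c y = 0 := by
  rw [Finset.sum_eq_zero_iff_of_nonneg fun y _ => mul_self_nonneg (c y)]
  exact ⟨fun h y => mul_self_eq_zero.mp (h y (Finset.mem_univ y)), fun h y _ => mul_self_eq_zero.mpr (h y)⟩

section Letters

variable (n : ℕ) (a : ℝ) (s : ℕ) [NeZero s]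
  {Dop Aop : lp (fun _ : X d => ℝ) ∞ →L[ℝ] lp (fun _ : X d => ℝ) ∞}
  (hD : ∀ (f : lp (fun _ : X d => ℝ) ∞) (y : X d), Dop f y = (((n : ℝ) + 1) ^ d)⁻¹ * ∑ p ∈ B n y, f p)
  (hA : ∀ (f : lp (fun _ : X d => ℝ) ∞) (p : X d), Aop f p = ∑ r ∈ nbhd n p, AX n a p r * f r)
  {Ef : (Site d ((n + 1) * s) → ℝ) →L[ℝ] lp (fun _ : X d => ℝ) ∞}
  (hEf : ∀ (g : Site d ((n + 1) * s) → ℝ) (q : X d), Ef g q = g (siteOf d ((n + 1) * s) q))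
  {Rf : lp (fun _ : X d => ℝ) ∞ →L[ℝ] (Site d ((n + 1) * s) → ℝ)}
  (hRf : ∀ (h : lp (fun _ : X d => ℝ) ∞) (x : Site d ((n + 1) * s)), Rf h x = h (windowMap d ((n + 1) * s) x))
  {Ec : (Site d s → ℝ) →L[ℝ] lp (fun _ : X d => ℝ) ∞}
  {Rc : lp (fun _ : X d => ℝ) ∞ →L[ℝ] (Site d s → ℝ)}
  (hRc : ∀ (h : lp (fun _ : X d => ℝ) ∞) (x : Site d s), Rc h x = h (windowMap d s x))

include hA hEf in
/-- **UNDER THE SITEWISE EQUATION THE FIELD EQUATION AT ANY LATTICE SITE IS THE BLOCK MEAN AT THE TORUS BLOCK OF ITS CLASS**: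
`(A(Ef φ))(p) + u((Ef φ)(p)) = λ(φ)(bt (siteOf p))` (periodicity: PTC `apply_windowMap_siteOf`; reading: TDF `apply_windowMap_of_blockConst`).
[folklore] -/
theorem fieldEq_apply_eq_blockMean (φ : Site d ((n + 1) * s) → ℝ) (u : ℝ → ℝ)
    (heq : ∀ p : X d, Aop (Ef φ) p + u (Ef φ p)
      = (((n : ℝ) + 1) ^ d)⁻¹ * ∑ p' ∈ B n (blk n p), (Aop (Ef φ) p' + u (Ef φ p')))
    (p : X d) :
    Aop (Ef φ) p + u (Ef φ p)
      = (((n : ℝ) + 1) ^ d)⁻¹ * ∑ p' ∈ B n (windowMap d s (siteOf d s (blk n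
          (windowMap d ((n + 1) * s) (siteOf d ((n + 1) * s) p))))), (Aop (Ef φ) p' + u (Ef φ p')) := by
  have hper := fieldEq_periodic n a s hA hEf φ u
  have hperN : ∀ q t : X d, (fun q => Aop (Ef φ) q + u (Ef φ q)) (q + (((n + 1) * s : ℕ) : ℤ) • t)
      = (fun q => Aop (Ef φ) q + u (Ef φ q)) q := fun q t => by
    beta_reduce
    rw [natCast_mul_smul_eq]
    exact hper q t
  have h1 := apply_windowMap_siteOf (s := (n + 1) * s) (h := fun q => Aop (Ef φ) q + u (Ef φ q)) hperN p
  beta_reduce at h1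
  rw [← h1]
  exact apply_windowMap_of_blockConst n s (F := fun q => Aop (Ef φ) q + u (Ef φ q)) hper heq _

include hA hEf in
/-- **VANISHING BLOCK MEANS FORCE THE FIELD EQUATION TO VANISH IDENTICALLY** (under the sitewise equation): if `λ(φ) y = 0` for every
coarse torus site then `(A(Ef φ))(p) + u((Ef φ)(p)) = 0` at every lattice site — SISL's «zeros lift» on the torus. [folklore] -/
theorem fieldEq_eq_zero_of_blockMean_eq_zero (φ : Site d ((n + 1) * s) → ℝ) (u : ℝ → ℝ)
    (heq : ∀ p : X d, Aop (Ef φ) p + u (Ef φ p)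
      = (((n : ℝ) + 1) ^ d)⁻¹ * ∑ p' ∈ B n (blk n p), (Aop (Ef φ) p' + u (Ef φ p')))
    (hbm : ∀ y : Site d s, (((n : ℝ) + 1) ^ d)⁻¹ * ∑ p' ∈ B n (windowMap d s y), (Aop (Ef φ) p' + u (Ef φ p')) = 0)
    (p : X d) : Aop (Ef φ) p + u (Ef φ p) = 0 := by
  rw [fieldEq_apply_eq_blockMean n a s hA hEf φ u heq p]
  exact hbm _

/-- Conversely, if the field equation vanishes identically then every block mean of it vanishes. [folklore] -/
theorem blockMean_eq_zero_of_fieldEq_eq_zero (φ : Site d ((n + 1) * s) → ℝ) (u : ℝ → ℝ)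
    (h0 : ∀ p : X d, Aop (Ef φ) p + u (Ef φ p) = 0) (y : Site d s) :
    (((n : ℝ) + 1) ^ d)⁻¹ * ∑ p' ∈ B n (windowMap d s y), (Aop (Ef φ) p' + u (Ef φ p')) = 0 := by
  rw [Finset.sum_eq_zero fun p' _ => h0 p', mul_zero]

/-! ## §2. Critical points of the torus effective action, letters form -/

include hD hA hEf hRf hRc in
/-- **THE CRITICAL POINTS OF THE TORUS EFFECTIVE ACTION ARE THE COARSE FIELDS WHOSE BACKGROUND SOLVES THE UNCONSTRAINED FIELD
EQUATION** (letters form): under INST §3's letters at `wt` (`σt = Rf∘σ∘Ec`, response `D` at `Ec wt`, `Rc(Q′(Ef(Dt k))) = k`, the sitewise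
equation at `σt wt`), `fderiv (S∘σt) wt = 0 ↔ ∀ p, (A(Ef(σt wt)))(p) + u((Ef(σt wt))(p)) = 0`. [folklore] -/
theorem fderiv_effectiveAction_torus_eq_zero_iff {v u : ℝ → ℝ} (hv : ∀ t, HasDerivAt v (u t) t)
    {σ : lp (fun _ : X d => ℝ) ∞ → lp (fun _ : X d => ℝ) ∞} {σt : (Site d s → ℝ) → (Site d ((n + 1) * s) → ℝ)}
    (hσt : ∀ wt, σt wt = Rf (σ (Ec wt))) {wt : Site d s → ℝ} {D : lp (fun _ : X d => ℝ) ∞ →L[ℝ] lp (fun _ : X d => ℝ) ∞}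
    (hDσ : HasFDerivAt σ D (Ec wt)) (hsec : ∀ k : Site d s → ℝ, Rc (Dop (Ef (((Rf.comp D).comp Ec) k))) = k)
    (heq : ∀ p : X d, Aop (Ef (σt wt)) p + u (Ef (σt wt) p)
      = (((n : ℝ) + 1) ^ d)⁻¹ * ∑ p' ∈ B n (blk n p), (Aop (Ef (σt wt)) p' + u (Ef (σt wt) p'))) :
    fderiv ℝ (fun w : Site d s → ℝ =>
        (1 / 2 : ℝ) * ∑ x, σt w x * ((Rf.comp Aop).comp Ef) (σt w) x + ∑ x, v (σt w x)) wt = 0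
      ↔ ∀ p : X d, Aop (Ef (σt wt)) p + u (Ef (σt wt) p) = 0 := by
  have happ := fderiv_effectiveAction_torus_apply n a s hD hA hEf hRf hRc hv hσt hDσ hsec heq
  have hvol : (((n : ℝ) + 1) ^ d) ≠ 0 := by positivity
  constructor
  · intro h0
    -- the gradient vanishes on `k := λ(wt)`: a sum of squares
    have hbm : ∀ y : Site d s,
        (((n : ℝ) + 1) ^ d)⁻¹ * ∑ p' ∈ B n (windowMap d s y), (Aop (Ef (σt wt)) p' + u (Ef (σt wt) p')) = 0 := by
      refine (sum_mul_self_eq_zero_iff _).mp ?_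
      have e := happ fun y => (((n : ℝ) + 1) ^ d)⁻¹ * ∑ p' ∈ B n (windowMap d s y), (Aop (Ef (σt wt)) p' + u (Ef (σt wt) p'))
      rw [h0, zero_apply] at e
      exact (mul_eq_zero.mp e.symm).resolve_left hvol
    exact fieldEq_eq_zero_of_blockMean_eq_zero n a s hA hEf (σt wt) u heq hbm
  · intro h0
    ext k
    rw [happ k, zero_apply]
    simp only [blockMean_eq_zero_of_fieldEq_eq_zero n s (σt wt) u h0, zero_mul, Finset.sum_const_zero, mul_zero]

end Letters

/-! ## §3. The instance on SBTL's localised small-field background -/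

/-- **CRITICAL POINTS OF THE TORUS EFFECTIVE ACTION AT THE SMALL-FIELD BACKGROUND** (`d ≥ 3`; SBTL's binders VERBATIM + a primitive `v`
of `u`; every coarse period `s ≥ 1`): SBTL's `Q′ ∕ A ∕ σ`, carriers and `σt` re-exported with their actions, `σt 0 = 0` and SBTL's
closed-ball identification VERBATIM (`σt wt ∈ closedBall 0 r`, `Ef(σt wt) = σ(Ec wt)`, `Q′(Ef(σt wt)) = Ec wt`, `Rc(Q′(Ef(σt wt))) = wt`,
the sitewise equation — the five letters that PIN `σt` by SBTL's torus uniqueness; without them the zero background would witness the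
package), AND on the open torus ball `‖wt‖ < (N⁻¹ − c)r`:
`fderiv (S∘σt) wt = 0 ↔ ∀ p, (A(σ(Ec wt)))(p) + u((σ(Ec wt))(p)) = 0` — `wt` is a critical point of the torus effective action iff its
background solves the unconstrained field equation on the lattice. [folklore] -/
theorem exists_effectiveAction_critical_torus (hd : 3 ≤ d) (n : ℕ) {a : ℝ} (ha : 0 < a)
    {v u u' : ℝ → ℝ} (hv : ∀ t, HasDerivAt v (u t) t) (hu : ∀ t, HasDerivAt u (u' t) t) (hu0 : u 0 = 0) {lam c N : ℝ≥0}
    (hlam : ∀ t, |u' t| ≤ lam) {L : ℝ} (hL0 : 0 ≤ L) (hL : ∀ s t, |u' s - u' t| ≤ L * |s - t|)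
    (hN : cHs d a * latticeConst d (deltaH d a)
        + ((cG0 d * cKL d (d - 2) + cSplit d a) * Real.exp (2 * deltaU d a)
            + cFar d a * Real.exp (4 * deltaU d a) / deltaU d a ^ 2) * latticeConst d (deltaU d a / 4)
          * (1 + cHs d a * latticeConst d (deltaH d a)) ≤ (N : ℝ))
    (hc : 2 * lam ≤ c) (hcN : c < N⁻¹) {r : ℝ} (hr : 0 ≤ r) (s : ℕ) [NeZero s] :
    ∃ (Dop Aop : lp (fun _ : X d => ℝ) ∞ →L[ℝ] lp (fun _ : X d => ℝ) ∞)
      (σ : lp (fun _ : X d => ℝ) ∞ → lp (fun _ : X d => ℝ) ∞)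
      (Ef : (Site d ((n + 1) * s) → ℝ) →L[ℝ] lp (fun _ : X d => ℝ) ∞)
      (Rf : lp (fun _ : X d => ℝ) ∞ →L[ℝ] (Site d ((n + 1) * s) → ℝ))
      (Ec : (Site d s → ℝ) →L[ℝ] lp (fun _ : X d => ℝ) ∞)
      (Rc : lp (fun _ : X d => ℝ) ∞ →L[ℝ] (Site d s → ℝ))
      (σt : (Site d s → ℝ) → (Site d ((n + 1) * s) → ℝ)),
      (∀ (f : lp (fun _ : X d => ℝ) ∞) (y : X d), Dop f y = (((n : ℝ) + 1) ^ d)⁻¹ * ∑ p ∈ B n y, f p) ∧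
      (∀ (f : lp (fun _ : X d => ℝ) ∞) (p : X d), Aop f p = ∑ r ∈ nbhd n p, AX n a p r * f r) ∧
      (∀ (g : Site d ((n + 1) * s) → ℝ) (q : X d), Ef g q = g (siteOf d ((n + 1) * s) q)) ∧
      (∀ (h : lp (fun _ : X d => ℝ) ∞) (x : Site d ((n + 1) * s)), Rf h x = h (windowMap d ((n + 1) * s) x)) ∧
      (∀ (g : Site d s → ℝ) (q : X d), Ec g q = g (siteOf d s q)) ∧
      (∀ (h : lp (fun _ : X d => ℝ) ∞) (x : Site d s), Rc h x = h (windowMap d s x)) ∧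
      (∀ wt, σt wt = Rf (σ (Ec wt))) ∧ σt 0 = 0 ∧
      -- SBTL's closed-ball identification of the torus background (the closed-ball FIVE, verbatim): it PINS `σt` — by SBTL's
      -- torus-uniqueness clause ∕ (74) `eq_of_sitewise` any torus field with these block means and this sitewise equation IS `σt wt`
      (∀ wt ∈ closedBall (0 : Site d s → ℝ) (((N : ℝ)⁻¹ - c) * r),
        σt wt ∈ closedBall 0 r ∧ Ef (σt wt) = σ (Ec wt) ∧ Dop (Ef (σt wt)) = Ec wt ∧ Rc (Dop (Ef (σt wt))) = wt ∧
          ∀ p : X d, Aop (Ef (σt wt)) p + u (Ef (σt wt) p)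
            = (((n : ℝ) + 1) ^ d)⁻¹ * ∑ p' ∈ B n (blk n p), (Aop (Ef (σt wt)) p' + u (Ef (σt wt) p'))) ∧
      -- THE CRITICAL POINTS on the open torus ball
      ∀ wt ∈ ball (0 : Site d s → ℝ) (((N : ℝ)⁻¹ - c) * r),
        (fderiv ℝ (fun w : Site d s → ℝ =>
            (1 / 2 : ℝ) * ∑ x, σt w x * ((Rf.comp Aop).comp Ef) (σt w) x + ∑ x, v (σt w x)) wt = 0
          ↔ ∀ p : X d, Aop (σ (Ec wt)) p + u (σ (Ec wt) p) = 0) := by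
  obtain ⟨Dop, Aop, Pop, N', σ, Cf, Ef, Rf, Ec, Rc, σt, hD, hA, -, -, -, -, -, -, -, hEf, hRf, hEc, hRc, -, -, -, -, hσt, hσt0,
    hball, -, -, htorus⟩ := exists_background_torus_localised hd n ha hu hu0 hlam hL0 hL hN hc hcN hr s
  refine ⟨Dop, Aop, σ, Ef, Rf, Ec, Rc, σt, hD, hA, hEf, hRf, hEc, hRc, hσt, hσt0, hball, fun wt hwt => ?_⟩
  obtain ⟨⟨D, hDσ, -, -, -, hsec⟩, -, -, -⟩ := htorus wt hwt
  have hcl := hball wt (ball_subset_closedBall hwt)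
  rw [← hcl.2.1]
  exact fderiv_effectiveAction_torus_eq_zero_iff n a s hD hA hEf hRf hRc hv hσt hDσ hsec hcl.2.2.2.2

/-! ## §4. Toy -/

/-- Toy: two real numbers whose squares sum to zero are zero (§1 on `Fin 2`). -/
example (c : Fin 2 → ℝ) (h : ∑ y, c y * c y = 0) : c 0 = 0 := (sum_mul_self_eq_zero_iff c).mp h 0

end Summit.QuantumFields.BalabanUV.T4Continuum.NE7b.SupTorusEffectiveActionCritical

end
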